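import Mathlib
import Summits.ValiantsHypothesis.ValiantsHypothesis.Theorems.NewtonUnitEquationsDissociatedUniformTorusLogKCell
import Summits.ValiantsHypothesis.ValiantsHypothesis.Theorems.NewtonUnitEquationsDissociatedUniformStubZerosDepth
import Summits.ValiantsHypothesis.ValiantsHypothesis.Theorems.NewtonUnitEquationsDissociatedUniformStubZerosCrossNovelty
import Summits.ValiantsHypothesis.ValiantsHypothesis.Theorems.NewtonUnitEquationsDissociatedUniformStubSubframeShadow

/-!
# Crux `DissociatedUniform` has exponent `O(log k)` on ALL frames — I: the per-cell bound with zeros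

Line `greedy-basis-shadow` of crux stmt-ValiantsHypothesis-5905, lead c7 by-product.  The torus theorem (`…TorusLogKCell`,
lead c6) needed every letter alive in every product; here structural ZEROS are resolved.  Every greedy word `a` of a
cell has a GOOD product `i` — alive at `a`, `≤ k − 1` demotions from the top word `t^i` of its alive box
(`stub_zerosDepth`, via LEMMA Z `stub_goodProduct`); with reference `t^i` every demotion of an `i`-good greedy word is a
`(2k−2)`-pool element of the DOUBLED colored family in `ℂ^(2k)` (`stub_zerosCrossNovelty`; deleted colors = the other
demoted coordinates and the `≤ k` fragile ones), so (`stub_coloredNovelty`, pool `≤ (2k−1)·2k ≤ 4k²`) the `i`-good words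
live on `≤ 4k²` coordinates with `≤ 4k² + 1` letters and `stub_subframeShadow` embeds them into the shadow of that
sub-frame: `≤ k·Q` greedy words per cell for EVERY frame, `Q` = any shadow bound for `k`-product frames with `≤ 4k²`
coordinates and `≤ 4k²+1` letters (`perCell_of_bound`: the count REDUCES to small frames, `m` eliminated); by Theorem Q
`≤ k·(4k² + 3)(8(k+2)³)^⌈log₂ 4k²⌉` (`perCell`).  Part II (`…ZerosLogK`) sums cells and charts.
-/

set_option linter.dupNamespace false

noncomputable section

open scoped BigOperators

namespace Summit.ValiantsHypothesis.ValiantsHypothesis.Theorems.NewtonUnitEquationsDissociatedUniform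

namespace ZerosLogK

/-- **Per-cell KERNEL REDUCTION for ALL frames (zeros allowed).**  If every `k`-product frame on `n ≤ 4k²`
coordinates with `≤ 4k² + 1` letters per coordinate has frame shadow of size `≤ Q`, then on a cell `Λ` of the chart
`ε X + λ Y` the greedy words of an ARBITRARY frame (any `m`) met at injective parameters number at most `k · Q` —
Lemma Z (`stub_zerosDepth`) gives every greedy word a GOOD product `i` (alive at the word, `≤ k - 1` demotions from
the top word `τ i` of its alive box); for fixed `i` the demotions of the `i`-good greedy words are `(2k-2)`-pool
elements of the doubled colored family (`stub_zerosCrossNovelty` + `stub_coloredNovelty` in `ℂ^(2k)`), hence live on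
`≤ 4k²` coordinates with `≤ 4k² + 1` letters each, and `stub_subframeShadow` embeds them into the shadow of that
sub-frame.  The coordinate number `m` is thereby eliminated from the crux unconditionally. -/
theorem perCell_of_bound (k m Q : ℕ) (A : Fin m → Finset (Fin 2 →₀ ℕ)) (f : Fin k → Fin m → MvPolynomial (Fin 2) ℂ)
    (ε : ℝ) (Λ : Set ℝ)
    (hQ : ∀ n : ℕ, n ≤ 4 * k ^ 2 → ∀ (A' : Fin n → Finset (Fin 2 →₀ ℕ)) (f' : Fin k → Fin n → MvPolynomial (Fin 2) ℂ),
      (∀ i, (A' i).card ≤ 4 * k ^ 2 + 1) → (QuasiPoly.fshadow A' f').ncard ≤ Q)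
    (hcell : ∀ (j j' : Fin m), ∀ l₁ ∈ A j, ∀ l₂ ∈ A j, ∀ l₃ ∈ A j', ∀ l₄ ∈ A j', ∀ lam ∈ Λ, ∀ lam' ∈ Λ,
      ((ε * ((((l₁ 0 : ℕ) : ℝ)) - (((l₂ 0 : ℕ) : ℝ)) - (((l₃ 0 : ℕ) : ℝ)) + (((l₄ 0 : ℕ) : ℝ))) +
          lam * ((((l₁ 1 : ℕ) : ℝ)) - (((l₂ 1 : ℕ) : ℝ)) - (((l₃ 1 : ℕ) : ℝ)) + (((l₄ 1 : ℕ) : ℝ))) < 0 ↔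
        ε * ((((l₁ 0 : ℕ) : ℝ)) - (((l₂ 0 : ℕ) : ℝ)) - (((l₃ 0 : ℕ) : ℝ)) + (((l₄ 0 : ℕ) : ℝ))) +
          lam' * ((((l₁ 1 : ℕ) : ℝ)) - (((l₂ 1 : ℕ) : ℝ)) - (((l₃ 1 : ℕ) : ℝ)) + (((l₄ 1 : ℕ) : ℝ))) < 0) ∧
      (0 < ε * ((((l₁ 0 : ℕ) : ℝ)) - (((l₂ 0 : ℕ) : ℝ)) - (((l₃ 0 : ℕ) : ℝ)) + (((l₄ 0 : ℕ) : ℝ))) +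
          lam * ((((l₁ 1 : ℕ) : ℝ)) - (((l₂ 1 : ℕ) : ℝ)) - (((l₃ 1 : ℕ) : ℝ)) + (((l₄ 1 : ℕ) : ℝ))) ↔
        0 < ε * ((((l₁ 0 : ℕ) : ℝ)) - (((l₂ 0 : ℕ) : ℝ)) - (((l₃ 0 : ℕ) : ℝ)) + (((l₄ 0 : ℕ) : ℝ))) +
          lam' * ((((l₁ 1 : ℕ) : ℝ)) - (((l₂ 1 : ℕ) : ℝ)) - (((l₃ 1 : ℕ) : ℝ)) + (((l₄ 1 : ℕ) : ℝ)))))) :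
    {a : Fin m → (Fin 2 →₀ ℕ) | ∃ lam ∈ Λ,
        Set.InjOn (fun b : Fin m → (Fin 2 →₀ ℕ) => ε * QuasiPoly.Xf b + lam * QuasiPoly.Yf b) (Fintype.piFinset A) ∧
        a ∈ QuasiPoly.gE (Fintype.piFinset A) (QuasiPoly.col f)
          (fun b : Fin m → (Fin 2 →₀ ℕ) => ε * QuasiPoly.Xf b + lam * QuasiPoly.Yf b)}.ncard ≤ k * Q := by
  classical
  -- letter heights and the set of cell words
  set lhf : ℝ → (Fin 2 →₀ ℕ) → ℝ := fun lam l => ε * ((l 0 : ℕ) : ℝ) + lam * ((l 1 : ℕ) : ℝ) with hlhf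
  set W := {a : Fin m → (Fin 2 →₀ ℕ) | ∃ lam ∈ Λ,
        Set.InjOn (fun b : Fin m → (Fin 2 →₀ ℕ) => ε * QuasiPoly.Xf b + lam * QuasiPoly.Yf b) (Fintype.piFinset A) ∧
        a ∈ QuasiPoly.gE (Fintype.piFinset A) (QuasiPoly.col f)
          (fun b : Fin m → (Fin 2 →₀ ℕ) => ε * QuasiPoly.Xf b + lam * QuasiPoly.Yf b)} with hW
  rcases Set.eq_empty_or_nonempty W with hWe | ⟨a₀, lam₀, hlam₀, hinj₀, ha₀⟩
  · rw [hWe, Set.ncard_empty]; exact Nat.zero_le _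
  have ha₀E : a₀ ∈ Fintype.piFinset A := ha₀.1
  have ha₀A : ∀ j, a₀ j ∈ A j := Fintype.mem_piFinset.mp ha₀E
  -- letter heights at `lam₀` are injective within a coordinate
  have hletter : ∀ j, ∀ l ∈ A j, ∀ l' ∈ A j, lhf lam₀ l = lhf lam₀ l' → l = l' := by
    intro j l hl l' hl' h
    have hupd : ∀ l'' ∈ A j, Function.update a₀ j l'' ∈ Fintype.piFinset A := fun l'' hl'' => by
      refine Fintype.mem_piFinset.mpr fun j' => ?_
      by_cases hj : j' = j
      · subst hj; simpa using hl''
      · rw [Function.update_of_ne hj]; exact ha₀A j'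
    have hheq : ε * QuasiPoly.Xf (Function.update a₀ j l) + lam₀ * QuasiPoly.Yf (Function.update a₀ j l) =
        ε * QuasiPoly.Xf (Function.update a₀ j l') + lam₀ * QuasiPoly.Yf (Function.update a₀ j l') := by
      rw [TorusLogK.hgt_update, TorusLogK.hgt_update]
      simp only [hlhf] at h
      linarith
    simpa using congrFun (hinj₀ (hupd l hl) (hupd l' hl') hheq) j
  -- transport of single-letter comparisons along the cell
  have hcmp : ∀ lam ∈ Λ, ∀ j, ∀ l ∈ A j, ∀ l' ∈ A j, (lhf lam l < lhf lam l' ↔ lhf lam₀ l < lhf lam₀ l') := by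
    intro lam hlam j l hl l' hl'
    have h := (hcell j j l hl l' hl' l' hl' l' hl' lam hlam lam₀ hlam₀).1
    simp only [hlhf]
    constructor
    · intro hlt
      have : ε * ((((l 0 : ℕ) : ℝ)) - (((l' 0 : ℕ) : ℝ)) - (((l' 0 : ℕ) : ℝ)) + (((l' 0 : ℕ) : ℝ))) +
          lam * ((((l 1 : ℕ) : ℝ)) - (((l' 1 : ℕ) : ℝ)) - (((l' 1 : ℕ) : ℝ)) + (((l' 1 : ℕ) : ℝ))) < 0 := by linarith
      have := h.mp this
      linarith
    · intro hlt
      have : ε * ((((l 0 : ℕ) : ℝ)) - (((l' 0 : ℕ) : ℝ)) - (((l' 0 : ℕ) : ℝ)) + (((l' 0 : ℕ) : ℝ))) +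
          lam₀ * ((((l 1 : ℕ) : ℝ)) - (((l' 1 : ℕ) : ℝ)) - (((l' 1 : ℕ) : ℝ)) + (((l' 1 : ℕ) : ℝ))) < 0 := by linarith
      have := h.mpr this
      linarith
  -- the top letters of the alive boxes (junk where a product has no alive letter)
  have hτex : ∀ (i : Fin k) (j : Fin m), ∃ τj ∈ A j, ((∃ l ∈ A j, (f i j).coeff l ≠ 0) →
      ((f i j).coeff τj ≠ 0 ∧ ∀ l ∈ A j, (f i j).coeff l ≠ 0 → lhf lam₀ l ≤ lhf lam₀ τj)) := by
    intro i j
    by_cases hex : ∃ l ∈ A j, (f i j).coeff l ≠ 0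
    · have hne : ((A j).filter fun l => (f i j).coeff l ≠ 0).Nonempty := by
        obtain ⟨l, hl, hl'⟩ := hex
        exact ⟨l, Finset.mem_filter.mpr ⟨hl, hl'⟩⟩
      obtain ⟨τj, hτj, hmax⟩ := Finset.exists_max_image _ (lhf lam₀) hne
      rw [Finset.mem_filter] at hτj
      exact ⟨τj, hτj.1, fun _ => ⟨hτj.2, fun l hl hl' => hmax l (Finset.mem_filter.mpr ⟨hl, hl'⟩)⟩⟩
    · exact ⟨a₀ j, ha₀A j, fun h => absurd h hex⟩
  choose τ hτA hτtop using hτex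
  -- the per-product sets of `i`-good greedy words
  set Wi : Fin k → Set (Fin m → (Fin 2 →₀ ℕ)) := fun i => {a : Fin m → (Fin 2 →₀ ℕ) | ∃ lam ∈ Λ,
        Set.InjOn (fun b : Fin m → (Fin 2 →₀ ℕ) => ε * QuasiPoly.Xf b + lam * QuasiPoly.Yf b) (Fintype.piFinset A) ∧
        a ∈ QuasiPoly.gE (Fintype.piFinset A) (QuasiPoly.col f)
          (fun b : Fin m → (Fin 2 →₀ ℕ) => ε * QuasiPoly.Xf b + lam * QuasiPoly.Yf b) ∧
        (∀ j, (f i j).coeff (a j) ≠ 0) ∧ (Finset.univ.filter fun j => a j ≠ τ i j).card + 1 ≤ k} with hWi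
  have hWifin : ∀ i, (Wi i).Finite := fun i =>
    (Fintype.piFinset A).finite_toSet.subset fun a ha => by
      obtain ⟨lam, -, -, ha, -⟩ := ha
      exact ha.1
  -- every greedy word of the cell is `i`-good for some `i` (Lemma Z)
  have hcover : W ⊆ ⋃ i, Wi i := by
    rintro a ⟨lam, hlam, hinj, ha⟩
    have haA : ∀ j, a j ∈ A j := Fintype.mem_piFinset.mp ha.1
    obtain ⟨i, halive, hdepth⟩ := stub_zerosDepth k m A f ε lam a hinj ha
    refine Set.mem_iUnion.mpr ⟨i, lam, hlam, hinj, ha, halive, le_trans ?_ hdepth⟩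
    refine Nat.add_le_add_right (Finset.card_le_card fun j hj => ?_) 1
    rw [Finset.mem_filter] at hj ⊢
    refine ⟨hj.1, τ i j, hτA i j, ?_⟩
    obtain ⟨hτalive, hτmax⟩ := hτtop i j ⟨a j, haA j, halive j⟩
    refine ⟨hτalive, ?_⟩
    have hle : lhf lam₀ (a j) ≤ lhf lam₀ (τ i j) := hτmax (a j) (haA j) (halive j)
    have hne : lhf lam₀ (a j) ≠ lhf lam₀ (τ i j) := fun h => hj.2 (hletter j (a j) (haA j) (τ i j) (hτA i j) h)
    have hlt := (hcmp lam hlam j (a j) (haA j) (τ i j) (hτA i j)).mpr (lt_of_le_of_ne hle hne)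
    simpa [hlhf] using hlt
  -- the bound for one product
  have hbound : ∀ i, (Wi i).ncard ≤ Q := by
    intro i
    by_cases hne : ∀ j, ∃ l ∈ A j, (f i j).coeff l ≠ 0
    swap
    · have hempty : Wi i = ∅ := by
        refine Set.eq_empty_iff_forall_notMem.mpr fun a ha => ?_
        obtain ⟨lam, -, -, ha, halive, -⟩ := ha
        have haA : ∀ j, a j ∈ A j := Fintype.mem_piFinset.mp ha.1
        exact hne fun j => ⟨a j, haA j, halive j⟩
      rw [hempty, Set.ncard_empty]; exact Nat.zero_le _
    have hτalive : ∀ j, (f i j).coeff (τ i j) ≠ 0 := fun j => (hτtop i j (hne j)).1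
    -- weights and the transport of their order
    set wtf : ℝ → (Fin m × (Fin 2 →₀ ℕ)) → ℝ := fun lam d => lhf lam (τ i d.1) - lhf lam d.2 with hwtf
    have hwt : ∀ lam ∈ Λ, ∀ d d' : Fin m × (Fin 2 →₀ ℕ), d.2 ∈ A d.1 → d'.2 ∈ A d'.1 →
        (wtf lam d' < wtf lam d ↔ wtf lam₀ d' < wtf lam₀ d) := by
      intro lam hlam d d' hd hd'
      have h := (hcell d.1 d'.1 (τ i d.1) (hτA i _) d.2 hd (τ i d'.1) (hτA i _) d'.2 hd' lam hlam lam₀ hlam₀).2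
      simp only [hwtf, hlhf]
      constructor
      · intro hlt
        have : 0 < ε * ((((τ i d.1 0 : ℕ) : ℝ)) - (((d.2 0 : ℕ) : ℝ)) - (((τ i d'.1 0 : ℕ) : ℝ)) + (((d'.2 0 : ℕ) : ℝ))) +
            lam * ((((τ i d.1 1 : ℕ) : ℝ)) - (((d.2 1 : ℕ) : ℝ)) - (((τ i d'.1 1 : ℕ) : ℝ)) + (((d'.2 1 : ℕ) : ℝ))) := by
          linarith
        have := h.mp this
        linarith
      · intro hlt
        have : 0 < ε * ((((τ i d.1 0 : ℕ) : ℝ)) - (((d.2 0 : ℕ) : ℝ)) - (((τ i d'.1 0 : ℕ) : ℝ)) + (((d'.2 0 : ℕ) : ℝ))) +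
            lam₀ * ((((τ i d.1 1 : ℕ) : ℝ)) - (((d.2 1 : ℕ) : ℝ)) - (((τ i d'.1 1 : ℕ) : ℝ)) + (((d'.2 1 : ℕ) : ℝ))) := by
          linarith
        have := h.mpr this
        linarith
    -- the demotions, their doubled vectors (read through `finProdFinEquiv`), weights and colors
    set Dm : Finset (Fin m × (Fin 2 →₀ ℕ)) :=
      (Finset.univ ×ˢ Finset.univ.biUnion A).filter fun d => d.2 ∈ A d.1 ∧ d.2 ≠ τ i d.1 with hDm
    have mem_Dm : ∀ d : Fin m × (Fin 2 →₀ ℕ), d ∈ Dm ↔ d.2 ∈ A d.1 ∧ d.2 ≠ τ i d.1 := by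
      intro d
      simp only [hDm, Finset.mem_filter, Finset.mem_product, Finset.mem_univ, Finset.mem_biUnion, true_and]
      exact ⟨fun h => h.2, fun h => ⟨⟨d.1, h.1⟩, h⟩⟩
    set ZW : (Fin m × (Fin 2 →₀ ℕ)) → (Fin 2 × Fin k) → ℂ := fun d p =>
      if p.1 = 0 then (f p.2 d.1).coeff d.2 / (f p.2 d.1).coeff (τ i d.1)
      else (if (f p.2 d.1).coeff (τ i d.1) = 0 then (f p.2 d.1).coeff d.2 else 0) with hZW
    set eqv : Fin 2 × Fin k ≃ Fin (2 * k) := finProdFinEquiv with heqv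
    set v : (Fin m × (Fin 2 →₀ ℕ)) → Fin (2 * k) → ℂ := fun d q => ZW d (eqv.symm q) with hv
    have hfun : ∀ d, LinearMap.funLeft ℂ ℂ eqv (v d) = ZW d := by
      intro d
      funext p
      simp [hv, LinearMap.funLeft_apply]
    set w : (Fin m × (Fin 2 →₀ ℕ)) → ℝ := wtf lam₀ with hw
    have hwinj : Set.InjOn w Dm := by
      intro d hd d' hd' hdd
      rw [Finset.mem_coe, mem_Dm] at hd hd'
      have hbE : Function.update (τ i) d.1 d.2 ∈ Fintype.piFinset A := by
        refine Fintype.mem_piFinset.mpr fun j => ?_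
        by_cases hj : j = d.1
        · subst hj; simpa using hd.1
        · rw [Function.update_of_ne hj]; exact hτA i j
      have hbE' : Function.update (τ i) d'.1 d'.2 ∈ Fintype.piFinset A := by
        refine Fintype.mem_piFinset.mpr fun j => ?_
        by_cases hj : j = d'.1
        · subst hj; simpa using hd'.1
        · rw [Function.update_of_ne hj]; exact hτA i j
      have hheq : ε * QuasiPoly.Xf (Function.update (τ i) d.1 d.2) + lam₀ * QuasiPoly.Yf (Function.update (τ i) d.1 d.2) =
          ε * QuasiPoly.Xf (Function.update (τ i) d'.1 d'.2) + lam₀ * QuasiPoly.Yf (Function.update (τ i) d'.1 d'.2) := by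
        rw [TorusLogK.hgt_update, TorusLogK.hgt_update]
        simp only [hw, hwtf, hlhf] at hdd
        linarith
      have hbb := hinj₀ hbE hbE' hheq
      by_cases h1 : d.1 = d'.1
      · have h2 : d.2 = d'.2 := by
          have := congrFun hbb d.1
          rw [Function.update_self, h1, Function.update_self] at this
          exact this
        exact Prod.ext h1 h2
      · have := congrFun hbb d.1
        rw [Function.update_self, Function.update_of_ne h1] at this
        exact absurd this hd.2
    -- the pool and its size (colored novelty in `ℂ^(2k)`, `s = 2k - 2`)
    set S : Set (Fin m × (Fin 2 →₀ ℕ)) := {d | d ∈ Dm ∧ ∃ J : Finset (Fin m), J.card ≤ 2 * k - 2 ∧ d.1 ∉ J ∧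
        v d ∉ Submodule.span ℂ (v '' {d' | d' ∈ Dm ∧ w d' < w d ∧ d'.1 ∉ J})} with hS
    have hSfin : S.Finite := Dm.finite_toSet.subset fun d hd => hd.1
    have hScard : S.ncard ≤ (2 * k - 2 + 1) * (2 * k) :=
      stub_coloredNovelty (Fin m × (Fin 2 →₀ ℕ)) (Fin m) (2 * k) (2 * k - 2) Dm v w Prod.fst
        (fun j : Fin m => ((j : ℕ) : ℂ))
        (fun j j' (h : ((j : ℕ) : ℂ) = ((j' : ℕ) : ℂ)) => Fin.ext (by exact_mod_cast h)) hwinj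
    set poolF : Finset (Fin m × (Fin 2 →₀ ℕ)) := hSfin.toFinset with hpoolF
    have mem_poolF : ∀ d, d ∈ poolF ↔ d ∈ S := fun d => Set.Finite.mem_toFinset hSfin
    have hpoolF_card : poolF.card ≤ 4 * k ^ 2 := by
      rw [show poolF.card = S.ncard from (Set.ncard_eq_toFinset_card S hSfin).symm]
      refine hScard.trans ?_
      have h2 : 2 * k - 2 + 1 ≤ 2 * k ∨ k = 0 := by omega
      rcases h2 with h2 | h2
      · calc (2 * k - 2 + 1) * (2 * k) ≤ (2 * k) * (2 * k) := Nat.mul_le_mul_right _ h2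
          _ = 4 * k ^ 2 := by ring
      · subst h2; simp
    -- every demotion of an `i`-good greedy word of the cell is a pool element
    have hcontain : ∀ lam ∈ Λ, ∀ a : Fin m → (Fin 2 →₀ ℕ),
        Set.InjOn (fun b : Fin m → (Fin 2 →₀ ℕ) => ε * QuasiPoly.Xf b + lam * QuasiPoly.Yf b) (Fintype.piFinset A) →
        a ∈ QuasiPoly.gE (Fintype.piFinset A) (QuasiPoly.col f)
          (fun b : Fin m → (Fin 2 →₀ ℕ) => ε * QuasiPoly.Xf b + lam * QuasiPoly.Yf b) →
        (Finset.univ.filter fun j => a j ≠ τ i j).card + 1 ≤ k →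
        ∀ j, a j ≠ τ i j → (j, a j) ∈ S := by
      intro lam hlam a hinj ha hdepth j hj
      have haA : ∀ j, a j ∈ A j := Fintype.mem_piFinset.mp ha.1
      have hcross := stub_zerosCrossNovelty k m A f ε lam (τ i) a j (hτA i) ha hj
      set D : Finset (Fin m) := Finset.univ.filter fun j' => a j' ≠ τ i j' with hD
      have hjD : j ∈ D := Finset.mem_filter.mpr ⟨Finset.mem_univ _, hj⟩
      -- the fragile coordinates: unique death witnesses of `a[j ↦ τ i j]`
      set a' : Fin m → (Fin 2 →₀ ℕ) := Function.update a j (τ i j) with ha'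
      set Fr : Finset (Fin m) := Finset.univ.filter fun j' => ∃ i' : Fin k, (f i' j').coeff (a' j') = 0 ∧
          ∀ j'', j'' ≠ j' → (f i' j'').coeff (a' j'') ≠ 0 with hFr
      have hFrcard : Fr.card ≤ k := by
        let g : Fin k → Fin m := fun i' => if h : ∃ j', (f i' j').coeff (a' j') = 0 then h.choose else j
        have hsub : Fr ⊆ Finset.univ.image g := by
          intro j' hj'
          obtain ⟨i', hdead, halive'⟩ := (Finset.mem_filter.mp hj').2
          refine Finset.mem_image.mpr ⟨i', Finset.mem_univ _, ?_⟩
          have hex : ∃ j'', (f i' j'').coeff (a' j'') = 0 := ⟨j', hdead⟩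
          have hg : g i' = hex.choose := dif_pos hex
          rw [hg]
          by_contra hne'
          exact halive' _ hne' hex.choose_spec
        calc Fr.card ≤ (Finset.univ.image g).card := Finset.card_le_card hsub
          _ ≤ Finset.univ.card := Finset.card_image_le
          _ = k := by simp
      set J : Finset (Fin m) := D.erase j ∪ Fr.erase j with hJ
      have hJcard : J.card ≤ 2 * k - 2 := by
        have h1 : J.card ≤ (D.erase j).card + (Fr.erase j).card := Finset.card_union_le _ _
        have h2 : (D.erase j).card = D.card - 1 := Finset.card_erase_of_mem hjD
        have := Finset.card_erase_le (s := Fr) (a := j); have := Finset.card_pos.mpr ⟨j, hjD⟩; omega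
      refine ⟨(mem_Dm _).mpr ⟨haA j, hj⟩, J, hJcard, ?_, ?_⟩
      · simp [hJ, Finset.mem_union, Finset.mem_erase]
      · intro hmem
        apply hcross
        have h1 := Submodule.apply_mem_span_image_of_mem_span (LinearMap.funLeft ℂ ℂ eqv) hmem
        rw [hfun, ← Set.image_comp] at h1
        have hcomp : ((LinearMap.funLeft ℂ ℂ ⇑eqv) ∘ v) = ZW := funext hfun
        rw [hcomp] at h1
        refine Submodule.span_mono (Set.image_mono ?_) h1
        intro d' hd'
        obtain ⟨hd'Dm, hlt, hd'J⟩ := hd'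
        rw [mem_Dm] at hd'Dm
        refine ⟨hd'Dm.1, hd'Dm.2, ?_, ?_⟩
        · have h := (hwt lam hlam (j, a j) d' (haA j) hd'Dm.1).mpr hlt
          simpa [hwtf, hlhf] using h
        · by_cases h1 : d'.1 = j
          · exact Or.inl h1
          · right
            have hnD : d'.1 ∉ D := fun h => hd'J (Finset.mem_union_left _ (Finset.mem_erase.mpr ⟨h1, h⟩))
            have hnFr : d'.1 ∉ Fr := fun h => hd'J (Finset.mem_union_right _ (Finset.mem_erase.mpr ⟨h1, h⟩))
            have heq' : a d'.1 = τ i d'.1 := by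
              by_contra hne'
              exact hnD (Finset.mem_filter.mpr ⟨Finset.mem_univ _, hne'⟩)
            refine ⟨heq', ?_⟩
            rintro ⟨i', hdead, halive'⟩
            apply hnFr
            refine Finset.mem_filter.mpr ⟨Finset.mem_univ _, i', ?_, ?_⟩
            · simp only [ha', Function.update_of_ne h1, heq']
              exact hdead
            · intro j'' hj''
              exact halive' j'' hj''
    -- the coordinate set and the letter sets of the sub-box
    set P : Finset (Fin m) := poolF.image Prod.fst with hP
    set B : Fin m → Finset (Fin 2 →₀ ℕ) := fun j => insert (τ i j) ((poolF.filter fun d => d.1 = j).image Prod.snd)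
      with hB
    have hBA : ∀ j, B j ⊆ A j := by
      intro j l hl
      rcases Finset.mem_insert.mp hl with rfl | hl
      · exact hτA i j
      · obtain ⟨d, hd, rfl⟩ := Finset.mem_image.mp hl
        obtain ⟨hdpool, hdj⟩ := Finset.mem_filter.mp hd
        exact hdj ▸ ((mem_Dm d).mp ((mem_poolF d).mp hdpool).1).1
    have hτB : ∀ j, τ i j ∈ B j := fun j => Finset.mem_insert_self _ _
    have hBcard : ∀ j, (B j).card ≤ 4 * k ^ 2 + 1 := by
      intro j
      calc (B j).card ≤ ((poolF.filter fun d => d.1 = j).image Prod.snd).card + 1 := Finset.card_insert_le _ _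
        _ ≤ (poolF.filter fun d => d.1 = j).card + 1 := by gcongr; exact Finset.card_image_le
        _ ≤ poolF.card + 1 := by gcongr; exact Finset.filter_subset _ _
        _ ≤ 4 * k ^ 2 + 1 := by gcongr
    have hsubW : Wi i ⊆ {a : Fin m → (Fin 2 →₀ ℕ) | (∃ lam ∈ Λ,
        Set.InjOn (fun b : Fin m → (Fin 2 →₀ ℕ) => ε * QuasiPoly.Xf b + lam * QuasiPoly.Yf b) (Fintype.piFinset A) ∧
        a ∈ QuasiPoly.gE (Fintype.piFinset A) (QuasiPoly.col f)
          (fun b : Fin m → (Fin 2 →₀ ℕ) => ε * QuasiPoly.Xf b + lam * QuasiPoly.Yf b)) ∧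
        (∀ j, j ∉ P → a j = τ i j) ∧ (∀ j, a j ∈ B j)} := by
      rintro a ⟨lam, hlam, hinj, ha, halive, hdepth⟩
      have key : ∀ j, a j ≠ τ i j → (j, a j) ∈ poolF := fun j hj =>
        (mem_poolF _).mpr (hcontain lam hlam a hinj ha hdepth j hj)
      refine ⟨⟨lam, hlam, hinj, ha⟩, ?_, ?_⟩
      · intro j hjP
        by_contra hne'
        exact hjP (Finset.mem_image.mpr ⟨(j, a j), key j hne', rfl⟩)
      · intro j
        by_cases hja : a j = τ i j
        · rw [hja]; exact hτB j
        · exact Finset.mem_insert_of_mem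
            (Finset.mem_image.mpr ⟨(j, a j), Finset.mem_filter.mpr ⟨key j hja, rfl⟩, rfl⟩)
    have hbigfin : {a : Fin m → (Fin 2 →₀ ℕ) | (∃ lam ∈ Λ,
        Set.InjOn (fun b : Fin m → (Fin 2 →₀ ℕ) => ε * QuasiPoly.Xf b + lam * QuasiPoly.Yf b) (Fintype.piFinset A) ∧
        a ∈ QuasiPoly.gE (Fintype.piFinset A) (QuasiPoly.col f)
          (fun b : Fin m → (Fin 2 →₀ ℕ) => ε * QuasiPoly.Xf b + lam * QuasiPoly.Yf b)) ∧
        (∀ j, j ∉ P → a j = τ i j) ∧ (∀ j, a j ∈ B j)}.Finite :=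
      (Fintype.piFinset A).finite_toSet.subset fun a ha => by
        obtain ⟨⟨lam, -, -, ha⟩, -⟩ := ha
        exact ha.1
    have hPcard : P.card ≤ 4 * k ^ 2 := Finset.card_image_le.trans hpoolF_card
    have hcount := stub_subframeShadow k m (4 * k ^ 2 + 1) Q A f ε Λ (τ i) P B hBA hτB hBcard
      (fun A' f' hA' => hQ P.card hPcard A' f' hA')
    calc (Wi i).ncard ≤ _ := Set.ncard_le_ncard hsubW hbigfin
      _ ≤ Q := hcount
  -- sum over the products
  calc W.ncard ≤ (⋃ i, Wi i).ncard := Set.ncard_le_ncard hcover (Set.finite_iUnion hWifin)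
    _ ≤ ∑ i, (Wi i).ncard := Set.ncard_iUnion_le_of_fintype _
    _ ≤ ∑ _i : Fin k, Q := Finset.sum_le_sum fun i _ => hbound i
    _ = k * Q := by simp [Finset.sum_const, Finset.card_univ, Fintype.card_fin]

/-- **Per-cell bound for ALL frames (zeros allowed)**, Theorem-Q form: `≤ k·(4k² + 3)(8(k+2)³)^⌈log₂ 4k²⌉` greedy
words per cell — `perCell_of_bound` with Theorem Q's shadow bound `QuasiPoly.ncard_fshadow_le` on the small sub-frames. -/
theorem perCell (k m : ℕ) (A : Fin m → Finset (Fin 2 →₀ ℕ)) (f : Fin k → Fin m → MvPolynomial (Fin 2) ℂ)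
    (ε : ℝ) (Λ : Set ℝ)
    (hcell : ∀ (j j' : Fin m), ∀ l₁ ∈ A j, ∀ l₂ ∈ A j, ∀ l₃ ∈ A j', ∀ l₄ ∈ A j', ∀ lam ∈ Λ, ∀ lam' ∈ Λ,
      ((ε * ((((l₁ 0 : ℕ) : ℝ)) - (((l₂ 0 : ℕ) : ℝ)) - (((l₃ 0 : ℕ) : ℝ)) + (((l₄ 0 : ℕ) : ℝ))) +
          lam * ((((l₁ 1 : ℕ) : ℝ)) - (((l₂ 1 : ℕ) : ℝ)) - (((l₃ 1 : ℕ) : ℝ)) + (((l₄ 1 : ℕ) : ℝ))) < 0 ↔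
        ε * ((((l₁ 0 : ℕ) : ℝ)) - (((l₂ 0 : ℕ) : ℝ)) - (((l₃ 0 : ℕ) : ℝ)) + (((l₄ 0 : ℕ) : ℝ))) +
          lam' * ((((l₁ 1 : ℕ) : ℝ)) - (((l₂ 1 : ℕ) : ℝ)) - (((l₃ 1 : ℕ) : ℝ)) + (((l₄ 1 : ℕ) : ℝ))) < 0) ∧
      (0 < ε * ((((l₁ 0 : ℕ) : ℝ)) - (((l₂ 0 : ℕ) : ℝ)) - (((l₃ 0 : ℕ) : ℝ)) + (((l₄ 0 : ℕ) : ℝ))) +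
          lam * ((((l₁ 1 : ℕ) : ℝ)) - (((l₂ 1 : ℕ) : ℝ)) - (((l₃ 1 : ℕ) : ℝ)) + (((l₄ 1 : ℕ) : ℝ))) ↔
        0 < ε * ((((l₁ 0 : ℕ) : ℝ)) - (((l₂ 0 : ℕ) : ℝ)) - (((l₃ 0 : ℕ) : ℝ)) + (((l₄ 0 : ℕ) : ℝ))) +
          lam' * ((((l₁ 1 : ℕ) : ℝ)) - (((l₂ 1 : ℕ) : ℝ)) - (((l₃ 1 : ℕ) : ℝ)) + (((l₄ 1 : ℕ) : ℝ)))))) :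
    {a : Fin m → (Fin 2 →₀ ℕ) | ∃ lam ∈ Λ,
        Set.InjOn (fun b : Fin m → (Fin 2 →₀ ℕ) => ε * QuasiPoly.Xf b + lam * QuasiPoly.Yf b) (Fintype.piFinset A) ∧
        a ∈ QuasiPoly.gE (Fintype.piFinset A) (QuasiPoly.col f)
          (fun b : Fin m → (Fin 2 →₀ ℕ) => ε * QuasiPoly.Xf b + lam * QuasiPoly.Yf b)}.ncard ≤
      k * ((4 * k ^ 2 + 3) * (8 * (k + 2) ^ 3) ^ Nat.clog 2 (4 * k ^ 2)) := by
  refine perCell_of_bound k m _ A f ε Λ (fun n hn A' f' hA' => ?_) hcell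
  calc (QuasiPoly.fshadow A' f').ncard ≤ (4 * k ^ 2 + 1 + 2) * (8 * (k + 2) ^ 3) ^ Nat.clog 2 n :=
        QuasiPoly.ncard_fshadow_le n k (4 * k ^ 2 + 1) A' f' hA'
    _ ≤ (4 * k ^ 2 + 3) * (8 * (k + 2) ^ 3) ^ Nat.clog 2 (4 * k ^ 2) := by
        have h1 : 4 * k ^ 2 + 1 + 2 = 4 * k ^ 2 + 3 := by ring
        rw [h1]
        exact Nat.mul_le_mul_left _ (Nat.pow_le_pow_right (by positivity) (Nat.clog_mono_right 2 hn))



end ZerosLogK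

/-- **Per-cell bound for all frames** (export of `ZerosLogK.perCell`, registered by-product stub `zeros_perCell`):
on a cell `Λ` of the chart `ε X + λ Y` the greedy words of an ARBITRARY frame (zeros allowed) met at injective
parameters number at most `k·(4k² + 3)(8(k+2)³)^⌈log₂ 4k²⌉`. -/
theorem zeros_perCell (k m : ℕ) (A : Fin m → Finset (Fin 2 →₀ ℕ)) (f : Fin k → Fin m → MvPolynomial (Fin 2) ℂ) (ε : ℝ) (Λ : Set ℝ) (hcell : ∀ (j j' : Fin m), ∀ l₁ ∈ A j, ∀ l₂ ∈ A j, ∀ l₃ ∈ A j', ∀ l₄ ∈ A j', ∀ lam ∈ Λ, ∀ lam' ∈ Λ, ((ε * ((((l₁ 0 : ℕ) : ℝ)) - (((l₂ 0 : ℕ) : ℝ)) - (((l₃ 0 : ℕ) : ℝ)) + (((l₄ 0 : ℕ) : ℝ))) + lam * ((((l₁ 1 : ℕ) : ℝ)) - (((l₂ 1 : ℕ) : ℝ)) - (((l₃ 1 : ℕ) : ℝ)) + (((l₄ 1 : ℕ) : ℝ))) < 0 ↔ ε * ((((l₁ 0 : ℕ) : ℝ)) - (((l₂ 0 : ℕ)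 : ℝ)) - (((l₃ 0 : ℕ) : ℝ)) + (((l₄ 0 : ℕ) : ℝ))) + lam' * ((((l₁ 1 : ℕ) : ℝ)) - (((l₂ 1 : ℕ) : ℝ)) - (((l₃ 1 : ℕ) : ℝ)) + (((l₄ 1 : ℕ) : ℝ))) < 0) ∧ (0 < ε * ((((l₁ 0 : ℕ) : ℝ)) - (((l₂ 0 : ℕ) : ℝ)) - (((l₃ 0 : ℕ) : ℝ)) + (((l₄ 0 : ℕ) : ℝ))) + lam * ((((l₁ 1 : ℕ) : ℝ)) - (((l₂ 1 : ℕ) : ℝ)) - (((l₃ 1 : ℕ) : ℝ)) + (((l₄ 1 : ℕ) : ℝ))) ↔ 0 < ε * ((((l₁ 0 : ℕ) : ℝ)) - (((l₂ 0 : ℕ) : ℝ)) - (((l₃ 0 : ℕ) : ℝ)) + (((l₄ 0 : ℕ) : ℝ))) + lam' * ((((l₁ 1 : ℕ) : ℝ)) - (((l₂ 1 : ℕ) : ℝ)) - (((l₃ 1 : ℕ) : ℝ)) + (((l₄ 1 : ℕ) : ℝ)))))) : {a : Fin m → (Fin 2 →₀ ℕ) | ∃ lam ∈ Λ, Set.InjOn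 (fun b : Fin m → (Fin 2 →₀ ℕ) => ε * QuasiPoly.Xf b + lam * QuasiPoly.Yf b) (Fintype.piFinset A) ∧ a ∈ QuasiPoly.gE (Fintype.piFinset A) (QuasiPoly.col f) (fun b : Fin m → (Fin 2 →₀ ℕ) => ε * QuasiPoly.Xf b + lam * QuasiPoly.Yf b)}.ncard ≤ k * ((4 * k ^ 2 + 3) * (8 * (k + 2) ^ 3) ^ Nat.clog 2 (4 * k ^ 2)) :=
  ZerosLogK.perCell k m A f ε Λ hcell

/-- **Per-cell kernel reduction for all frames** (export of `ZerosLogK.perCell_of_bound`, registered by-product stub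
`zeros_perCell_of_bound`): any uniform bound `Q` on the frame shadows of the `k`-product frames with `≤ 4k²`
coordinates and `≤ 4k² + 1` letters per coordinate bounds the greedy words of a cell of an ARBITRARY frame by `k·Q`
— the crux's per-cell count reduces to frames of size `poly(k)`, uniformly in `m`. -/
theorem zeros_perCell_of_bound (k m Q : ℕ) (A : Fin m → Finset (Fin 2 →₀ ℕ)) (f : Fin k → Fin m → MvPolynomial (Fin 2) ℂ) (ε : ℝ) (Λ : Set ℝ) (hQ : ∀ n : ℕ, n ≤ 4 * k ^ 2 → ∀ (A' : Fin n → Finset (Fin 2 →₀ ℕ)) (f' : Fin k → Fin n → MvPolynomial (Fin 2) ℂ), (∀ i, (A' i).card ≤ 4 * k ^ 2 + 1) → (QuasiPoly.fshadow A' f').ncard ≤ Q) (hcell : ∀ (j j' : Fin m), ∀ l₁ ∈ A j, ∀ l₂ ∈ A j, ∀ l₃ ∈ A j', ∀ l₄ ∈ A j', ∀ lam ∈ Λ, ∀ lam' ∈ Λ, ((ε * ((((l₁ 0 : ℕ) : ℝ)) - (((l₂ 0 : ℕ) : ℝ)) - (((l₃ 0 : ℕ) : ℝ)) + (((l₄ 0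 : ℕ) : ℝ))) + lam * ((((l₁ 1 : ℕ) : ℝ)) - (((l₂ 1 : ℕ) : ℝ)) - (((l₃ 1 : ℕ) : ℝ)) + (((l₄ 1 : ℕ) : ℝ))) < 0 ↔ ε * ((((l₁ 0 : ℕ) : ℝ)) - (((l₂ 0 : ℕ) : ℝ)) - (((l₃ 0 : ℕ) : ℝ)) + (((l₄ 0 : ℕ) : ℝ))) + lam' * ((((l₁ 1 : ℕ) : ℝ)) - (((l₂ 1 : ℕ) : ℝ)) - (((l₃ 1 : ℕ) : ℝ)) + (((l₄ 1 : ℕ) : ℝ))) < 0) ∧ (0 < ε * ((((l₁ 0 : ℕ) : ℝ)) - (((l₂ 0 : ℕ) : ℝ)) - (((l₃ 0 : ℕ) : ℝ)) + (((l₄ 0 : ℕ) : ℝ))) + lam * ((((l₁ 1 : ℕ) : ℝ)) - (((l₂ 1 : ℕ) : ℝ)) - (((l₃ 1 : ℕ) : ℝ)) + (((l₄ 1 : ℕ) : ℝ))) ↔ 0 < ε * ((((l₁ 0 : ℕ) : ℝ)) - (((l₂ 0 : ℕ) : ℝ)) - (((l₃ 0 : ℕ) : ℝ)) + (((l₄ 0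 : ℕ) : ℝ))) + lam' * ((((l₁ 1 : ℕ) : ℝ)) - (((l₂ 1 : ℕ) : ℝ)) - (((l₃ 1 : ℕ) : ℝ)) + (((l₄ 1 : ℕ) : ℝ)))))) : {a : Fin m → (Fin 2 →₀ ℕ) | ∃ lam ∈ Λ, Set.InjOn (fun b : Fin m → (Fin 2 →₀ ℕ) => ε * QuasiPoly.Xf b + lam * QuasiPoly.Yf b) (Fintype.piFinset A) ∧ a ∈ QuasiPoly.gE (Fintype.piFinset A) (QuasiPoly.col f) (fun b : Fin m → (Fin 2 →₀ ℕ) => ε * QuasiPoly.Xf b + lam * QuasiPoly.Yf b)}.ncard ≤ k * Q :=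
  ZerosLogK.perCell_of_bound k m Q A f ε Λ hQ hcell

end Summit.ValiantsHypothesis.ValiantsHypothesis.Theorems.NewtonUnitEquationsDissociatedUniform

end
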